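import Literature.MathematicalPhysics.QuantumFieldTheory.Balaban1983to89.Node00.MultiScaleFibreChart
import Literature.MathematicalPhysics.QuantumFieldTheory.Balaban1983to89.B15Claim189UnitTestAtRecord
import Literature.MathematicalPhysics.QuantumFieldTheory.Balaban1983to89.T3DescentFibreTower
import Summits.QuantumFields.YangMills.Theorems.UnitScaleTiltProp7IterLinearisationFlat
import Summits.QuantumFields.YangMills.Theorems.UnitScaleTiltProp8ChartDeriv

/-!
# BalabanUVNodes ∕ N12 — THE (J-b) JUNCTION, NODE-00 HALF: AT THE FLAT BACKGROUND THE DERIVATIVE OF NODE 00's MULTI-SCALE AVERAGING CHART IS THE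
# `linAvg`-RECURSION `Q^{(j)}` — the velocity of `t ↦ Ū^j(1·exp(tX))(c)` is `(Q^{(j)}X)(c)`, hence `(DΦ(0)X)_{(j,c)} = π((Q^{(j)}X)(c))` for n07-w2's canonical chart
# `Φ = msChart … 1` at the flat datum, so that dag-n12-w3's `hLH : DΨ(0)(H y) = y` READS «the linearised k-fold averages of `H y` reproduce `y` on the constrained bonds»

Cell `pub-ymgap` (HUMAN RULINGS D-0062 ∕ D-0149), width seat `pub-ymgap-dag-n10-w1` g0, plan g80 WORDS-1b CANDIDATE № 10 = START-LIST §n12 (J-b); module B of the cut announced on the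
bus (l.25856; n12-c NO-OBJECTION l.≈25906); module A = `Thm/BalabanUVNodesN12FlatConstraintPlaquetteJunction` (p592369 ✓: the V1 plaquette half).  Key K1⁷ `stmt-QuantumFields-20542`,
`--kind proof --supports … --as helper`; count-neutral; THEOREMS ONLY (0 `def`, 0 `sorry`, 0 `instance`).  CONSUMED BY NAME, nothing modified: the route UnitScaleTilt's QUANTITATIVE flat
linearisation `Prop7AvgLinearisation.norm_iter_sub_one_sub_iterLin_le` ([Balaban1985Averaging] Prop. 3 (122)–(125) iterated: `Ū^k(U) = 1 + Q^{(k)}(U − 1) + O(δ²)` on `SU`-valued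
fields `δ`-close to `1`), its letters `linAvg_sub`, `norm_linAvg_le`, `Prop8Chart.linAvg_const_smul`; n07-e's `Node00.hasDerivAt_coe_expChart_along` ∕ `hasDerivAt_ray` (`D exp(0) = id`); n07-w2's
`Node00.fderiv_msChart_apply_of_hasDerivAt` (the chart's derivative in velocity currency); `B15Claim189UnitTestAtRecord.iter_avOfRecord_one` ∕ `avgFamily_avOfRecord_one`,
`T3DescentFibreTower.small_one` (the flat datum is on the guard).

THE PRINT.  [Balaban1985Variational] Sect. C (44)–(48) p. 285 (the LINEARISED averaging `Q` of the variational problem and its right inverse `H`: (45) «L^jηQ_jHB = B on Λ_j»);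
[Balaban1985Averaging] Prop. 3 (121)–(125) p. 36 («the Taylor expansion of Q(V₀, A, c) begins with a first-order polynomial L(Q(V₀)A)_c»); [Balaban1987RG1] (0.4) p. 253, (0.21) p. 256
(the k-fold average).  PRECEDENT IN THE TREE (not transported): `UnitScaleTiltProp8ChartDeriv.fderiv_chartLog_zero_apply` proves the same sentence for the route UnitScaleTilt's
UNGUARDED `𝔸ˣ`-valued average in the complex chart `e^{iηA}`; THIS file proves it for NODE 00's GUARDED `SU(N)` averaging of record in n07-e's real chart `expChart`, by the
elementary route «quantitative remainder `O(δ²)` + `exp(tX) − 1 − tX = o(t)` ⇒ derivative».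

CONTENTS.
§1 (private plumbing) letters of the recursion family `Q` (`Q 0 Y = Y`, `Q (i+1) Y = linAvg (Q i Y)`): additivity, ℝ-homogeneity, the crude sup bound
   `‖Q k Z c‖ ≤ (3ℓ)^k·M` (`ℓ = (d+2)L`) — public twins: `FLContraction.iterLin_sub`, `LinearAvgMatrix.norm_iterLin_le`.
§2 `hasDerivAt_coe_expChart_one_smul`, `coe_expChart_one_zero_smul` (bond letters), ★★ `hasDerivAt_coe_iter_expChart_one_smul` — on ANY torus `P`, for the family `blockAvg expMeanLogSU` of (0.4): `HasDerivAt (t ↦ ↑(Ū^k(1·exp(tX))(c))) ((Q^{(k)}↑X)(c)) 0`.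
§3 AT NODE 00's OBJECTS (`avOfRecord F N K = fun _ => blockAvg expMeanLogSU`, `rfl`): `hasDerivAt_coe_avgFamily_expChart_one_smul`, `smallBelow_avOfRecord_one`, ★★★
   `fderiv_msChart_one_apply_eq_iterLin` — for EVERY level-bounded determining set `𝔹` and the flat datum `W := M˙(1) = 1`:
   `fderiv ℝ (msChart F N K k 𝔹 1 1) 0 X i = suProj N ((Q^{(j)}↑X)(c))` at the constrained bond `i ↔ (j, c)`; ★★ `rightInverse_iff_iterLin_reproduces` — a map `H` is a right inverse
   of `DΦ(0)` (dag-n12-w3's `hLH`) IFF `suProj N ((Q^{(j)}↑(H y))(c)) = y i` on every constrained bond (the k-fold linearised averages of `H y` reproduce `y` on `𝔹`); §1½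
   `walkSum_mem_lieSU` ∕ `linAvg_mem_lieSU` ∕ `iterLin_mem_lieSU` (`Q^{(k)}` preserves `𝔰𝔲(N)`-valued fields) and ★★ `iterLin_eq_of_rightInverse` (the matrix-level
   reproduction `(Q^{(j)}↑(H y))(c) = ↑(y_{(j,c)})`, no projection — module A's input).

HONEST FRAMING.  Real calculus + bookkeeping on the tree's own objects at the FLAT background only (`U₀ = 1`, the base point of [LF-II]'s `H⁰_{1,k}`); the recursion letter `Q` is
DISPLAYED (inhabited: `ChartHInv.exists_linFamily`); nothing of Bałaban's estimates asserted; the identification at curved backgrounds (the `W_j(c)*` twist and `U ≠ 1`) is NOT here;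
N12 NOT discharged; count-neutral (typed 28∕28 · discharged 5∕27 unmoved); one finite 𝕋⁴ programme at fixed ε — R4 closes the conditional rung `BalabanLadder.UV` only; the YM mass
gap (Clay) is NOT proved by any of this.  No `sorry`, no `def`, no `instance`, no `notation`.
-/

noncomputable section

open scoped BigOperators Matrix.Norms.L2Operator Topology
open Filter Asymptotics Finset

namespace Summit.QuantumFields.YangMills.BalabanUVNodes.N12FlatChartDerivIterLin

open Literature.MathematicalPhysics.QuantumFieldTheory.Balaban1983to89
open T4Continuum (T4Family)
open BlockAveraging (blockAvg)
open ExpMeanLog (expMeanLogSU deltaSU deltaSU_pos)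
open BlockAveragingEMLLinearised (linAvg)
open T4AdjointCovarianceUnitary (lieSU expSU)
open B15DeterminingSets
open Node00
open Summit.QuantumFields.YangMills.Theorems.Prop7AvgLinearisation (norm_iter_sub_one_sub_iterLin_le norm_linAvg_le linAvg_sub)
open Summit.QuantumFields.YangMills.Theorems.Prop8Chart (linAvg_const_smul)

/-! ## §1  Letters of the recursion-characterised `Q^{(k)}`: real linearity and the sup bound -/

section Letters

variable {P : Params} {n : Type*} [Fintype n] [DecidableEq n]

omit [Fintype n] [DecidableEq n] in
/-- `Q^{(k)}` of a difference (additivity through the recursion, `linAvg_sub`; private twin of the tree's `FLContraction.iterLin_sub` of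
`AlphaInputsT3ACv3FLExpUpdate`, kept local to spare this module that import closure). [cite: Balaban1985Averaging, (124)-(125) p.36] -/
private theorem iterLin_sub (Q : (i : ℕ) → (PBond P 0 → Matrix n n ℂ) → PBond P i → Matrix n n ℂ)
    (hQ0 : ∀ Y, Q 0 Y = Y) (hQs : ∀ (i : ℕ) (Y : PBond P 0 → Matrix n n ℂ) (c : PBond P (i + 1)), Q (i + 1) Y c = linAvg (Q i Y) c)
    (Y Y' : PBond P 0 → Matrix n n ℂ) : ∀ (k : ℕ) (c : PBond P k), Q k (fun b => Y b - Y' b) c = Q k Y c - Q k Y' c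
  | 0, c => by rw [hQ0, hQ0, hQ0]
  | k + 1, c => by
    have ih : Q k (fun b => Y b - Y' b) = fun b => Q k Y b - Q k Y' b := funext (iterLin_sub Q hQ0 hQs Y Y' k)
    rw [hQs, hQs, hQs, ih, linAvg_sub]

omit [Fintype n] [DecidableEq n] in
/-- A real scalar acts on a complex matrix as the corresponding complex scalar (private twin of the tree's `NE7FlatSkewSliceSolvable.real_smul_eq_coe_smul`, not imported
to keep this module's closure inside the N12 ∕ UnitScaleTilt libraries). [folklore] -/
private theorem real_smul_eq_coe_smul (r : ℝ) (M : Matrix n n ℂ) : r • M = (r : ℂ) • M := by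
  ext i j
  simp [Matrix.smul_apply, Complex.real_smul]

omit [Fintype n] [DecidableEq n] in
/-- `Q^{(k)}` is real-homogeneous (`linAvg_const_smul` through the recursion). [cite: Balaban1985Averaging, (124)-(125) p.36] -/
private theorem iterLin_real_smul (Q : (i : ℕ) → (PBond P 0 → Matrix n n ℂ) → PBond P i → Matrix n n ℂ)
    (hQ0 : ∀ Y, Q 0 Y = Y) (hQs : ∀ (i : ℕ) (Y : PBond P 0 → Matrix n n ℂ) (c : PBond P (i + 1)), Q (i + 1) Y c = linAvg (Q i Y) c)
    (r : ℝ) (Y : PBond P 0 → Matrix n n ℂ) : ∀ (k : ℕ) (c : PBond P k), Q k (fun b => r • Y b) c = r • Q k Y c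
  | 0, c => by rw [hQ0, hQ0]
  | k + 1, c => by
    have ih : Q k (fun b => r • Y b) = fun b => (r : ℂ) • Q k Y b :=
      funext fun b => by rw [iterLin_real_smul Q hQ0 hQs r Y k b, real_smul_eq_coe_smul]
    rw [hQs, hQs, ih, linAvg_const_smul, ← real_smul_eq_coe_smul]

/-- **SUP BOUND OF `Q^{(k)}`**: `‖(Q^{(k)}Z)(c)‖ ≤ (3ℓ)^k·M` whenever `‖Z_b‖ ≤ M` for all fine bonds (`ℓ = (d+2)L`; `norm_linAvg_le` iterated).
(A sharper entrywise bound is the tree's `LinearAvgMatrix.norm_iterLin_le`; this crude one is private plumbing.) [cite: Balaban1985Averaging, (124)-(125) p.36] -/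
private theorem norm_iterLin_le (Q : (i : ℕ) → (PBond P 0 → Matrix n n ℂ) → PBond P i → Matrix n n ℂ)
    (hQ0 : ∀ Y, Q 0 Y = Y) (hQs : ∀ (i : ℕ) (Y : PBond P 0 → Matrix n n ℂ) (c : PBond P (i + 1)), Q (i + 1) Y c = linAvg (Q i Y) c)
    (Z : PBond P 0 → Matrix n n ℂ) {M : ℝ} (hM : 0 ≤ M) (hZ : ∀ b, ‖Z b‖ ≤ M) :
    ∀ (k : ℕ) (c : PBond P k), ‖Q k Z c‖ ≤ (3 * (((P.d + 2) * P.L : ℕ) : ℝ)) ^ k * M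
  | 0, c => by rw [hQ0, pow_zero, one_mul]; exact hZ c
  | k + 1, c => by
    rw [hQs, pow_succ, mul_comm ((3 * (((P.d + 2) * P.L : ℕ) : ℝ)) ^ k), mul_assoc]
    exact norm_linAvg_le (Q k Z) (by positivity) (fun b => norm_iterLin_le Q hQ0 hQs Z hM hZ k b) c

end Letters

/-! ### §1½  `Q^{(k)}` preserves `𝔰𝔲(N)`-valued fields (real linear combinations of members) -/

section LieAlgebraValued

variable {P : Params} {N : ℕ}

/-- A signed sum along a walk of `𝔰𝔲(N)`-valued bond matrices is in `𝔰𝔲(N)`. [folklore] -/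
theorem walkSum_mem_lieSU {j : ℕ} {Y : PBond P j → Matrix (Fin N) (Fin N) ℂ} (hY : ∀ b, Y b ∈ lieSU (Fin N)) :
    ∀ γ : List (T4Continuum.LStep P j), BlockAveragingEMLLinearised.walkSum Y γ ∈ lieSU (Fin N)
  | [] => by rw [BlockAveragingEMLLinearised.walkSum_nil]; exact Submodule.zero_mem _
  | s :: γ => by
    rw [BlockAveragingEMLLinearised.walkSum_cons]
    refine Submodule.add_mem _ ?_ (walkSum_mem_lieSU hY γ)
    split_ifs
    · exact hY _
    · exact Submodule.neg_mem _ (hY _)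

/-- **NODE 00's linearised (0.4) average maps `𝔰𝔲(N)`-valued fields to `𝔰𝔲(N)`-valued fields** (its coefficients are real: the mean over the index set and `±1`).
[cite: Balaban1985Averaging, (124)-(125) p.36] -/
theorem linAvg_mem_lieSU {j : ℕ} {Y : PBond P j → Matrix (Fin N) (Fin N) ℂ} (hY : ∀ b, Y b ∈ lieSU (Fin N)) (c : PBond P (j + 1)) :
    linAvg Y c ∈ lieSU (Fin N) := by
  rw [BlockAveragingEMLLinearised.linAvg_def]
  have hr : ((Fintype.card (BlockAveraging.Idx P) : ℂ))⁻¹ = ((((Fintype.card (BlockAveraging.Idx P) : ℝ))⁻¹ : ℝ) : ℂ) := by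
    rw [Complex.ofReal_inv, Complex.ofReal_natCast]
  rw [hr, ← real_smul_eq_coe_smul]
  refine Submodule.smul_mem _ _ (Submodule.sum_mem _ fun i _ => ?_)
  exact Submodule.sub_mem _ (Submodule.add_mem _ (walkSum_mem_lieSU hY _) (walkSum_mem_lieSU hY _)) (walkSum_mem_lieSU hY _)

/-- **`Q^{(k)}` maps `𝔰𝔲(N)`-valued fields to `𝔰𝔲(N)`-valued fields.** [cite: Balaban1985Averaging, (124)-(125) p.36] -/
theorem iterLin_mem_lieSU (Q : (i : ℕ) → (PBond P 0 → Matrix (Fin N) (Fin N) ℂ) → PBond P i → Matrix (Fin N) (Fin N) ℂ)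
    (hQ0 : ∀ Y, Q 0 Y = Y) (hQs : ∀ (i : ℕ) (Y : PBond P 0 → Matrix (Fin N) (Fin N) ℂ) (c : PBond P (i + 1)), Q (i + 1) Y c = linAvg (Q i Y) c)
    {Y : PBond P 0 → Matrix (Fin N) (Fin N) ℂ} (hY : ∀ b, Y b ∈ lieSU (Fin N)) : ∀ (k : ℕ) (c : PBond P k), Q k Y c ∈ lieSU (Fin N)
  | 0, c => by rw [hQ0]; exact hY c
  | k + 1, c => by rw [hQs]; exact linAvg_mem_lieSU (fun b => iterLin_mem_lieSU Q hQ0 hQs hY k b) c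

end LieAlgebraValued


/-! ## §2  The velocity of the k-fold (0.4)-average along the flat exponential chart is `Q^{(k)}X` -/

section Velocity

variable {P : Params} {N : ℕ} [NeZero N]

/-- The matrix of the flat chart point `1·exp(tX)` at a bond is `exp(tX_b)`, and the bond curve has velocity `X_b` at `t = 0`. [cite: Balaban1985RegularSpaces, (1.10) p.77 (bookkeeping)] -/
theorem hasDerivAt_coe_expChart_one_smul (X : PBond P 0 → lieSU (Fin N)) (b : PBond P 0) :
    HasDerivAt (fun t : ℝ => ((expChart (1 : GaugeField P 0 (SU N)) (t • X) b : SU N) : Matrix (Fin N) (Fin N) ℂ))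
      (X b : Matrix (Fin N) (Fin N) ℂ) 0 := by
  have h := hasDerivAt_coe_expChart_along (U := (1 : GaugeField P 0 (SU N))) (hasDerivAt_ray X) (zero_smul ℝ X) b
  have h1 : (((1 : GaugeField P 0 (SU N)) b : SU N) : Matrix (Fin N) (Fin N) ℂ) = 1 := rfl
  rw [h1, one_mul] at h
  exact h

/-- At `t = 0` the flat chart point is the unit configuration, bond-wise as a matrix. [cite: Balaban1985RegularSpaces, (1.10) p.77 (bookkeeping)] -/
theorem coe_expChart_one_zero_smul (X : PBond P 0 → lieSU (Fin N)) (b : PBond P 0) :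
    ((expChart (1 : GaugeField P 0 (SU N)) ((0 : ℝ) • X) b : SU N) : Matrix (Fin N) (Fin N) ℂ) = 1 := by
  rw [zero_smul, expChart_zero]
  rfl

/-- The (0.4) family of record fixes the unit configuration at every level (generic torus): `Ū^k(1) = 1` (private twin of the tree's
`BalabanLadderUVSeamRecClassicalResponseDirichlet.iter_blockAvg_one` ∕ `B15Claim189UnitTestAtRecord.iter_avOfRecord_one`). [cite: Balaban1987RG1, (0.4) p.253 (bookkeeping)] -/
private theorem iter_blockAvg_one : ∀ k : ℕ,
    Averaging.iter (fun i => blockAvg (P := P) (j := i) (expMeanLogSU (n := Fin N))) k (1 : GaugeField P 0 (SU N)) = 1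
  | 0 => rfl
  | k + 1 => by
    show (blockAvg expMeanLogSU).avg (Averaging.iter (fun i => blockAvg (P := P) (j := i) (expMeanLogSU (n := Fin N))) k 1) = 1
    rw [iter_blockAvg_one k, BlockAveraging.blockAvg_avg]
    exact T3DescentFibreTower.avgFun_one _ T3DescentFibreTower.expMeanLogSU_E_one

/-- ★★ **THE VELOCITY OF THE k-FOLD (0.4)-AVERAGE ALONG THE FLAT CHART IS `Q^{(k)}X`.**  On any torus `P`, for the block averagings `blockAvg expMeanLogSU` of [Balaban1987RG1] (0.4), a
Lie-algebra field `X : bonds → 𝔰𝔲(N)`, a level `k` and a coarse bond `c`: the matrix curve `t ↦ Ū^k(1·exp(tX))(c)` has derivative `(Q^{(k)}↑X)(c)` at `t = 0`, where `Q^{(k)}` is the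
recursion-characterised composite of NODE 00's linearised one-step average `linAvg` (`Q 0 = id`, `Q (i+1) = linAvg ∘ Q i`).  Proof: the route UnitScaleTilt's quantitative expansion
`Ū^k(U) = 1 + Q^{(k)}(U − 1) + O(δ²)` (`norm_iter_sub_one_sub_iterLin_le`, valid once the bond matrices of `U` are `δ`-close to `1` with `δ` under the guards) at `U = exp(tX)`, where
`δ = O(t)`, plus `exp(tX_b) − 1 − tX_b = o(t)` through the bounded linear `Q^{(k)}`. [cite: Balaban1985Averaging, Prop. 3 (121)-(125) p.36; Balaban1985Variational, (44)-(45) p.285; Balaban1987RG1, (0.4) p.253, (0.21) p.256] -/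
theorem hasDerivAt_coe_iter_expChart_one_smul
    (Q : (i : ℕ) → (PBond P 0 → Matrix (Fin N) (Fin N) ℂ) → PBond P i → Matrix (Fin N) (Fin N) ℂ)
    (hQ0 : ∀ Y, Q 0 Y = Y) (hQs : ∀ (i : ℕ) (Y : PBond P 0 → Matrix (Fin N) (Fin N) ℂ) (c : PBond P (i + 1)), Q (i + 1) Y c = linAvg (Q i Y) c)
    (X : PBond P 0 → lieSU (Fin N)) (k : ℕ) (c : PBond P k) :
    HasDerivAt (fun t : ℝ => ((Averaging.iter (fun i => blockAvg (P := P) (j := i) (expMeanLogSU (n := Fin N))) k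
        (expChart (1 : GaugeField P 0 (SU N)) (t • X)) c : SU N) : Matrix (Fin N) (Fin N) ℂ))
      (Q k (fun b => (X b : Matrix (Fin N) (Fin N) ℂ)) c) 0 := by
  classical
  -- notation
  set ℓ : ℝ := (((P.d + 2) * P.L : ℕ) : ℝ) with hℓ
  set Xm : PBond P 0 → Matrix (Fin N) (Fin N) ℂ := fun b => (X b : Matrix (Fin N) (Fin N) ℂ) with hXm
  set γ : ℝ → GaugeField P 0 (SU N) := fun t => expChart (1 : GaugeField P 0 (SU N)) (t • X) with hγ
  set F : ℝ → Matrix (Fin N) (Fin N) ℂ := fun t =>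
    ((Averaging.iter (fun i => blockAvg (P := P) (j := i) (expMeanLogSU (n := Fin N))) k (γ t) c : SU N) : Matrix (Fin N) (Fin N) ℂ) with hF
  -- the bond curves `e_b(t) = exp(tX_b)` and their first-order data
  set e : PBond P 0 → ℝ → Matrix (Fin N) (Fin N) ℂ := fun b t => ((γ t b : SU N) : Matrix (Fin N) (Fin N) ℂ) with he
  have hde : ∀ b, HasDerivAt (e b) (Xm b) 0 := fun b => hasDerivAt_coe_expChart_one_smul X b
  have he0 : ∀ b, e b 0 = 1 := fun b => coe_expChart_one_zero_smul X b
  -- `D(t) = Σ_b ‖e_b(t) − 1‖ = O(t)` and `E(t) = Σ_b ‖e_b(t) − 1 − t•X_b‖ = o(t)`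
  set D : ℝ → ℝ := fun t => ∑ b, ‖e b t - 1‖ with hD
  set E : ℝ → ℝ := fun t => ∑ b, ‖e b t - 1 - t • Xm b‖ with hE
  have hD0 : ∀ t, 0 ≤ D t := fun t => Finset.sum_nonneg fun b _ => norm_nonneg _
  have hE0 : ∀ t, 0 ≤ E t := fun t => Finset.sum_nonneg fun b _ => norm_nonneg _
  have hDle : ∀ t b, ‖e b t - 1‖ ≤ D t := fun t b =>
    Finset.single_le_sum (f := fun b => ‖e b t - 1‖) (fun b _ => norm_nonneg _) (Finset.mem_univ b)
  have hEle : ∀ t b, ‖e b t - 1 - t • Xm b‖ ≤ E t := fun t b =>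
    Finset.single_le_sum (f := fun b => ‖e b t - 1 - t • Xm b‖) (fun b _ => norm_nonneg _) (Finset.mem_univ b)
  have hDO : D =O[𝓝 0] fun t : ℝ => t := by
    have h : ∀ b ∈ (Finset.univ : Finset (PBond P 0)), (fun t => ‖e b t - 1‖) =O[𝓝 0] fun t : ℝ => t := fun b _ => by
      have h1 := (hde b).isBigO_sub
      simp only [he0 b, sub_zero] at h1
      exact h1.norm_left
    exact IsBigO.sum h
  have hEo : E =o[𝓝 0] fun t : ℝ => t := by
    have h : ∀ b ∈ (Finset.univ : Finset (PBond P 0)), (fun t => ‖e b t - 1 - t • Xm b‖) =o[𝓝 0] fun t : ℝ => t := fun b _ => by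
      have h1 := (hasDerivAt_iff_isLittleO.1 (hde b))
      simp only [he0 b, sub_zero] at h1
      exact h1.norm_left
    exact IsLittleO.sum h
  have hDt : Tendsto D (𝓝 0) (𝓝 0) := by
    have h := hDO.trans_tendsto (tendsto_id : Tendsto (fun t : ℝ => t) (𝓝 0) (𝓝 0))
    exact h
  -- the guards hold for `t` near `0`
  have hℓ0 : 0 ≤ ℓ := Nat.cast_nonneg _
  have hguard : ∀ᶠ t in 𝓝 (0 : ℝ), 81 * ℓ * ((4 * ℓ) ^ k * D t) ≤ 1 ∧ 2 * (ℓ * ((4 * ℓ) ^ k * D t)) < deltaSU (Fin N) := by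
    have h1 : Tendsto (fun t => 81 * ℓ * ((4 * ℓ) ^ k * D t)) (𝓝 0) (𝓝 0) := by
      simpa using (hDt.const_mul ((4 * ℓ) ^ k)).const_mul (81 * ℓ)
    have h2 : Tendsto (fun t => 2 * (ℓ * ((4 * ℓ) ^ k * D t))) (𝓝 0) (𝓝 0) := by
      simpa using ((hDt.const_mul ((4 * ℓ) ^ k)).const_mul ℓ).const_mul 2
    filter_upwards [h1.eventually (eventually_le_nhds zero_lt_one), h2.eventually (eventually_lt_nhds (deltaSU_pos (n := Fin N)))]
      with t ht1 ht2
    exact ⟨ht1, ht2⟩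
  -- TERM 1: the quantitative remainder `‖F t − 1 − Q k (e(t) − 1) c‖ ≤ K·D(t)²` on the guard
  set K : ℝ := (k : ℝ) * (81 * ℓ ^ 2 * (4 * ℓ) ^ (2 * k)) with hK
  have hT1 : ∀ᶠ t in 𝓝 (0 : ℝ), ‖F t - 1 - Q k (fun b => e b t - 1) c‖ ≤ K * ‖D t * D t‖ := by
    filter_upwards [hguard] with t ht
    have h := norm_iter_sub_one_sub_iterLin_le (P := P) (n := Fin N) Q hQ0 hQs (γ t) (hD0 t) (fun b => hDle t b) k ht.1 ht.2
    have h2 := h.2 c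
    have hnn : ‖D t * D t‖ = D t ^ 2 := by rw [Real.norm_of_nonneg (mul_nonneg (hD0 t) (hD0 t)), pow_two]
    rw [hnn]
    calc ‖F t - 1 - Q k (fun b => e b t - 1) c‖ ≤ (k : ℝ) * (81 * ℓ ^ 2 * ((4 * ℓ) ^ (2 * k) * D t ^ 2)) := h2
      _ = K * D t ^ 2 := by rw [hK]; ring
  have hT1o : (fun t => F t - 1 - Q k (fun b => e b t - 1) c) =o[𝓝 0] fun t : ℝ => t := by
    have hO : (fun t => F t - 1 - Q k (fun b => e b t - 1) c) =O[𝓝 0] fun t => D t * D t := IsBigO.of_bound K hT1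
    have hDD : (fun t => D t * D t) =o[𝓝 0] fun t : ℝ => t := by
      have h1 : D =o[𝓝 0] fun _ : ℝ => (1 : ℝ) := by
        rw [isLittleO_one_iff]; exact hDt
      simpa using h1.mul_isBigO hDO
    exact hO.trans_isLittleO hDD
  -- TERM 2: `Q k (e(t) − 1) c − t • Q k X c = Q k (e(t) − 1 − t•X) c`, bounded by `(3ℓ)^k·E(t)`
  have hT2 : ∀ t, ‖Q k (fun b => e b t - 1) c - t • Q k Xm c‖ ≤ (3 * ℓ) ^ k * ‖E t‖ := by
    intro t
    have hlin : Q k (fun b => e b t - 1) c - t • Q k Xm c = Q k (fun b => e b t - 1 - t • Xm b) c := by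
      rw [← iterLin_real_smul Q hQ0 hQs t Xm k c, ← iterLin_sub Q hQ0 hQs (fun b => e b t - 1) (fun b => t • Xm b) k c]
    rw [hlin, Real.norm_of_nonneg (hE0 t)]
    exact norm_iterLin_le Q hQ0 hQs _ (hE0 t) (fun b => hEle t b) k c
  have hT2o : (fun t => Q k (fun b => e b t - 1) c - t • Q k Xm c) =o[𝓝 0] fun t : ℝ => t :=
    (IsBigO.of_bound ((3 * ℓ) ^ k) (Eventually.of_forall hT2)).trans_isLittleO hEo
  -- assembly: `F t − F 0 − t • Q k X c = TERM 1 + TERM 2`, `F 0 = 1`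
  have hF0 : F 0 = 1 := by
    show ((Averaging.iter (fun i => blockAvg (P := P) (j := i) (expMeanLogSU (n := Fin N))) k
      (expChart (1 : GaugeField P 0 (SU N)) ((0 : ℝ) • X)) c : SU N) : Matrix (Fin N) (Fin N) ℂ) = 1
    rw [zero_smul, expChart_zero, iter_blockAvg_one k]
    rfl
  rw [hasDerivAt_iff_isLittleO_nhds_zero]
  have hsum := hT1o.add hT2o
  refine hsum.congr' (Eventually.of_forall fun t => ?_) (Eventually.of_forall fun _ => rfl)
  simp only [hF0, zero_add]
  abel

end Velocity

/-! ## §3  At NODE 00's objects: the flat multi-scale chart's derivative is `π ∘ Q^{(j)}`, and what a right inverse of it says -/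

section NodeZero

variable {F : T4Family} {N : ℕ} [NeZero N] {K k : ℕ}

/-- The averaging OF RECORD is the (0.4) family of the torus `F.P K` (`rfl`), so §2 reads at NODE 00's `avgFamily (avOfRecord F N K)`: the velocity of
`t ↦ (M˙(1·exp(tX)))_j(c)` at `0` is `(Q^{(j)}↑X)(c)`. [cite: Balaban1987RG1, (0.4) p.253, (0.21) p.256; Balaban1988Convergent, (2.11) p.256] -/
theorem hasDerivAt_coe_avgFamily_expChart_one_smul
    (Q : (i : ℕ) → (PBond (F.P K) 0 → Matrix (Fin N) (Fin N) ℂ) → PBond (F.P K) i → Matrix (Fin N) (Fin N) ℂ)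
    (hQ0 : ∀ Y, Q 0 Y = Y) (hQs : ∀ (i : ℕ) (Y : PBond (F.P K) 0 → Matrix (Fin N) (Fin N) ℂ) (c : PBond (F.P K) (i + 1)), Q (i + 1) Y c = linAvg (Q i Y) c)
    (X : PBond (F.P K) 0 → lieSU (Fin N)) (j : ℕ) (c : PBond (F.P K) j) :
    HasDerivAt (fun t : ℝ => ((avgFamily (avOfRecord F N K) (expChart (1 : GaugeField (F.P K) 0 (SU N)) (t • X)) j c : SU N) :
        Matrix (Fin N) (Fin N) ℂ))
      (Q j (fun b => (X b : Matrix (Fin N) (Fin N) ℂ)) c) 0 :=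
  hasDerivAt_coe_iter_expChart_one_smul Q hQ0 hQs X j c

/-- **The flat configuration is on the guard of (0.4) at every level**: `SmallBelow (avOfRecord F N K) k 1` (`Ū^j(1) = 1` and the unit loop variables are at distance `0` from `1`).
[cite: Balaban1987RG1, (0.4) p.253] -/
theorem smallBelow_avOfRecord_one : SmallBelow (avOfRecord F N K) k (1 : GaugeField (F.P K) 0 (SU N)) := fun j _ c => by
  rw [B15Claim189UnitTestAtRecord.iter_avOfRecord_one F N K j]
  exact T3DescentFibreTower.small_one _ c

/-- The flat datum `W := M˙(1)` agrees with itself on every determining set (the `hU` binder of the chart theorems at `U = 1`). [cite: Balaban1988Convergent, (2.11) p.256 (bookkeeping)] -/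
theorem agreeOn_avgFamily_one (𝔹 : DetSet (F.P K)) :
    AgreeOn 𝔹 (avgFamily (avOfRecord F N K) (1 : GaugeField (F.P K) 0 (SU N))) (avgFamily (avOfRecord F N K) (1 : GaugeField (F.P K) 0 (SU N))) :=
  fun _ _ _ => rfl

/-- ★★★ **THE DERIVATIVE OF THE FLAT MULTI-SCALE CHART IS `π ∘ Q^{(j)}`.**  For every level-bounded determining set `𝔹` (constrained bonds of levels `≤ k`, enumerated by
`constrEnum 𝔹 k`), at the flat configuration `U = 1` with its own flat datum `W = M˙(1)`: the derivative at `0` of n07-w2's canonical chart `Φ = msChart F N K k 𝔹 W 1` applied to a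
direction `X : bonds → 𝔰𝔲(N)` has, at the constrained bond `i ↔ (j, c)`, the component `π((Q^{(j)}↑X)(c))` (`π = suProj N`, the identity on `𝔰𝔲(N)`; `W_j(c) = 1` untwists) — i.e.
`DΦ(0) = π ∘ Q^{(·)}` restricted to `𝔹`: the LINEARISED MULTI-SCALE (0.4)-CONSTRAINT of [Balaban1985Variational] (44)–(48) IS the `linAvg`-recursion.
[cite: Balaban1985Variational, (44)-(48) p.285; Balaban1985Averaging, Prop. 3 (121)-(125) p.36; Balaban1987RG1, (0.21) p.256] -/
theorem fderiv_msChart_one_apply_eq_iterLin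
    (Q : (i : ℕ) → (PBond (F.P K) 0 → Matrix (Fin N) (Fin N) ℂ) → PBond (F.P K) i → Matrix (Fin N) (Fin N) ℂ)
    (hQ0 : ∀ Y, Q 0 Y = Y) (hQs : ∀ (i : ℕ) (Y : PBond (F.P K) 0 → Matrix (Fin N) (Fin N) ℂ) (c : PBond (F.P K) (i + 1)), Q (i + 1) Y c = linAvg (Q i Y) c)
    (𝔹 : DetSet (F.P K)) (X : PBond (F.P K) 0 → lieSU (Fin N)) (i : Fin (constrCard 𝔹 k)) :
    fderiv ℝ (msChart F N K k 𝔹 (avgFamily (avOfRecord F N K) (1 : GaugeField (F.P K) 0 (SU N))) (1 : GaugeField (F.P K) 0 (SU N))) 0 X i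
      = suProj N (Q ((constrEnum 𝔹 k).symm i).1 (fun b => (X b : Matrix (Fin N) (Fin N) ℂ)) ((constrEnum 𝔹 k).symm i).2.1) := by
  have h := fderiv_msChart_apply_of_hasDerivAt (F := F) (N := N) (K := K) (k := k) (𝔹 := 𝔹) (agreeOn_avgFamily_one 𝔹) smallBelow_avOfRecord_one X i
    (hasDerivAt_coe_avgFamily_expChart_one_smul Q hQ0 hQs X _ _)
  have hW : star ((avgFamily (avOfRecord F N K) (1 : GaugeField (F.P K) 0 (SU N)) ((constrEnum 𝔹 k).symm i).1 ((constrEnum 𝔹 k).symm i).2.1 : SU N) :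
      Matrix (Fin N) (Fin N) ℂ) = 1 := by
    rw [B15Claim189UnitTestAtRecord.avgFamily_avOfRecord_one]
    exact star_one _
  rw [hW, one_mul] at h
  exact h

/-- ★★ **WHAT `DΨ(0) ∘ H = id` SAYS** (dag-n12-w3's binder `hLH : ∀ y, fderiv ℝ Ψ 0 (H y) = y` of `B11Eq177CriticalFamilyDerivative.fderiv_flatCriticalExpChartFamily_eq` at `Ψ :=` the flat
multi-scale chart): a map `H` from chart values to fine Lie-algebra fields is a right inverse of `DΦ(0)` IFF on every constrained bond `(j, c)` of `𝔹` the `j`-fold LINEARISED average of `H y`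
reproduces the datum, `π((Q^{(j)}↑(H y))(c)) = y_{(j,c)}` — the sentence module A turns into the plaquette statement. [cite: Balaban1985Variational, (45) p.285, (174)/(177) pp.305-306] -/
theorem rightInverse_iff_iterLin_reproduces
    (Q : (i : ℕ) → (PBond (F.P K) 0 → Matrix (Fin N) (Fin N) ℂ) → PBond (F.P K) i → Matrix (Fin N) (Fin N) ℂ)
    (hQ0 : ∀ Y, Q 0 Y = Y) (hQs : ∀ (i : ℕ) (Y : PBond (F.P K) 0 → Matrix (Fin N) (Fin N) ℂ) (c : PBond (F.P K) (i + 1)), Q (i + 1) Y c = linAvg (Q i Y) c)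
    (𝔹 : DetSet (F.P K)) (H : (Fin (constrCard 𝔹 k) → lieSU (Fin N)) → PBond (F.P K) 0 → lieSU (Fin N)) :
    (∀ y, fderiv ℝ (msChart F N K k 𝔹 (avgFamily (avOfRecord F N K) (1 : GaugeField (F.P K) 0 (SU N))) (1 : GaugeField (F.P K) 0 (SU N))) 0 (H y) = y) ↔
      ∀ (y : Fin (constrCard 𝔹 k) → lieSU (Fin N)) (i : Fin (constrCard 𝔹 k)),
        suProj N (Q ((constrEnum 𝔹 k).symm i).1 (fun b => (H y b : Matrix (Fin N) (Fin N) ℂ)) ((constrEnum 𝔹 k).symm i).2.1) = y i := by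
  constructor
  · intro h y i
    rw [← fderiv_msChart_one_apply_eq_iterLin Q hQ0 hQs 𝔹 (H y) i, h y]
  · intro h y
    funext i
    rw [fderiv_msChart_one_apply_eq_iterLin Q hQ0 hQs 𝔹 (H y) i, h y i]


/-- ★★ **THE RIGHT INVERSE REPRODUCES THE DATUM AS MATRICES** (no projection): since `Q^{(j)}` of the `𝔰𝔲(N)`-valued field `H y` is `𝔰𝔲(N)`-valued, `π` is the identity on it, so a right
inverse `H` of `DΦ(0)` satisfies `(Q^{(j)}↑(H y))(c) = ↑(y_{(j,c)})` on every constrained bond — the matrix-level reproduction that module A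
(`N12FlatConstraintPlaquetteJunction.oc_iterLin_comp_eq_of_reproduce` ∕ `chainLaw_iterLin_comp_linearMap`) turns into the chain binders `hYk ∕ hY`. [cite: Balaban1985Variational, (45) p.285] -/
theorem iterLin_eq_of_rightInverse
    (Q : (i : ℕ) → (PBond (F.P K) 0 → Matrix (Fin N) (Fin N) ℂ) → PBond (F.P K) i → Matrix (Fin N) (Fin N) ℂ)
    (hQ0 : ∀ Y, Q 0 Y = Y) (hQs : ∀ (i : ℕ) (Y : PBond (F.P K) 0 → Matrix (Fin N) (Fin N) ℂ) (c : PBond (F.P K) (i + 1)), Q (i + 1) Y c = linAvg (Q i Y) c)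
    (𝔹 : DetSet (F.P K)) (H : (Fin (constrCard 𝔹 k) → lieSU (Fin N)) → PBond (F.P K) 0 → lieSU (Fin N))
    (hH : ∀ y, fderiv ℝ (msChart F N K k 𝔹 (avgFamily (avOfRecord F N K) (1 : GaugeField (F.P K) 0 (SU N))) (1 : GaugeField (F.P K) 0 (SU N))) 0 (H y) = y)
    (y : Fin (constrCard 𝔹 k) → lieSU (Fin N)) (i : Fin (constrCard 𝔹 k)) :
    Q ((constrEnum 𝔹 k).symm i).1 (fun b => (H y b : Matrix (Fin N) (Fin N) ℂ)) ((constrEnum 𝔹 k).symm i).2.1 = (y i : Matrix (Fin N) (Fin N) ℂ) := by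
  have h := (rightInverse_iff_iterLin_reproduces Q hQ0 hQs 𝔹 H).1 hH y i
  have hmem : Q ((constrEnum 𝔹 k).symm i).1 (fun b => (H y b : Matrix (Fin N) (Fin N) ℂ)) ((constrEnum 𝔹 k).symm i).2.1 ∈ lieSU (Fin N) :=
    iterLin_mem_lieSU Q hQ0 hQs (fun b => (H y b).2) _ _
  rw [← h, coe_suProj_of_mem hmem]

end NodeZero

end Summit.QuantumFields.YangMills.BalabanUVNodes.N12FlatChartDerivIterLin

end
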